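import Mathlib.Analysis.SpecialFunctions.Trigonometric.Bounds
import Summits.QuantumFields.BalabanUV.T4Continuum.Spine.NE4.FadingFromRate

/-!
# Spine/NE4/FadingNeedsRegularity — the bottom rung of the regularity ladder at node U2: with LIPSCHITZ moduli alone (no C^{1,1}, no
# analyticity), NE4 + the uniform bound force NO decay of the history moduli at all

Cell `pub-balaban-gaps` (YM blitz G2), seat `ne4`, generation 5 (unit `pub-balaban-gaps-ne4-g5`); record `HOME/ne/NE4.md` §5 (R35).  Third panel of the
regularity ladder for node U2's third hypothesis (`T4CouplingMatching.FadingMemory`, the decay of the history moduli in the age):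
 * C^{0,1} (this file): NE4 + `|β| ≤ 1` + Lipschitz moduli with BOUNDED ROWS (one non-zero entry `π∕γ` per row) — and yet every admissible `Λ`
   has `Λ k 0 ≥ 2∕γ` at EVERY scale: `FadingMemory C θ′ Λ` fails for every `C` and every rate `θ′ < 1` (`not_fadingMemory_roughFamily`);
 * C^{1,1} (`Spine/NE4/FadingFromRate`, `…Sharp`, g3 (R29)): rate `√θ`, exact;
 * analytic in the couplings + complex NE4 (`Spine/NE4/FadingFromRateAnalytic`, `…AnalyticSharp`, g5 (R34)): rate `θ`, exact.
So the regularity input of (R29)∕(R34) is NECESSARY, not merely sufficient, for deriving the decay from NE4: at the Lipschitz level the third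
member of node U2's triple IS an independent hypothesis, and the only U2 road that dispenses with it is (E33)'s no-fading road (bounded row sums
⇒ K-uniform STRETCHED-exponential matching under the sign binder, `Beta.EriceRemainderEnclosureHistoryRenewal*`, census (R28)) — whose hypotheses
this witness meets (rows bounded by `π∕γ`).

THE WITNESS: `roughFamily θ γ k (g_0,…,g_k) = θ^k·sin(ρ_k·g_0)`, `ρ_k = (π∕γ)∕θ^k` — amplitude `θ^k` (so NE4 at rate `θ` with `c = 2`, and `|β| ≤ 1`),
frequency `θ^{−k}` (so the Lipschitz constant in `g_0` is `θ^k·ρ_k = π∕γ` at every scale: bounded, never fading).  Compare `FadingFromRateSharp.sharpFamily`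
(frequency `θ^{−k∕2}`: C^{1,1} with one constant, moduli `∼ (√θ)^k`).  An artificial inhabitant of the shapes, not a model of (1.22).

HONEST FRAMING: a toy family on the tree's HYPOTHESIS SHAPES; nothing of Bałaban's asserted; NE4 NOT IN PRINT, NOT PROVED; spine PROVED 0∕9
unchanged; NOT the continuum limit on ℝ⁴, NOT infinite volume, NOT a mass gap, NOT Clay.
-/

noncomputable section

namespace Summit.QuantumFields.BalabanUV.T4Continuum.Spine.NE4

open Set Real
open Literature.MathematicalPhysics.QuantumFieldTheory.Balaban1983to89
open Literature.MathematicalPhysics.QuantumFieldTheory.Balaban1983to89.FlowStep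
open Literature.MathematicalPhysics.QuantumFieldTheory.Balaban1983to89.T4CouplingMatching

/-! ## §1 The witness: NE4 at rate `θ`, uniform bound, bounded Lipschitz moduli -/

/-- The frequency of the witness at scale `k`: `ρ_k = (π∕γ)∕θ^k`. [folklore] -/
def roughFreq (θ γ : ℝ) (k : ℕ) : ℝ := (π / γ) / θ ^ k

/-- THE WITNESS FAMILY `β_{k+1}(g_0,…,g_k) = θ^k·sin(ρ_k·g_0)`: oldest coupling only, amplitude `θ^k`, frequency `θ^{−k}`. [folklore] -/
def roughFamily (θ γ : ℝ) : HBeta := fun k v => θ ^ k * Real.sin (roughFreq θ γ k * v 0)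

/-- `|roughFamily θ γ k v| ≤ θ^k` (`θ ≥ 0`). [folklore] -/
theorem abs_roughFamily_le_pow {θ γ : ℝ} (hθ0 : 0 ≤ θ) (k : ℕ) (v : Fin (k + 1) → ℝ) : |roughFamily θ γ k v| ≤ θ ^ k := by
  unfold roughFamily
  rw [abs_mul, abs_of_nonneg (pow_nonneg hθ0 k)]
  exact mul_le_of_le_one_right (pow_nonneg hθ0 k) (abs_sin_le_one _)

/-- The uniform bound `|roughFamily θ γ k v| ≤ 1` (`0 ≤ θ ≤ 1`). [folklore] -/
theorem abs_roughFamily_le_one {θ γ : ℝ} (hθ0 : 0 ≤ θ) (hθ1 : θ ≤ 1) (k : ℕ) (v : Fin (k + 1) → ℝ) :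
    |roughFamily θ γ k v| ≤ 1 :=
  (abs_roughFamily_le_pow hθ0 k v).trans (pow_le_one₀ hθ0 hθ1)

/-- **NE4 AT RATE `θ`**: `ScaleShiftRate 2 θ γ (roughFamily θ γ)` (both terms have amplitude `≤ θ^k`). [folklore] -/
theorem scaleShiftRate_roughFamily {θ γ : ℝ} (hθ0 : 0 ≤ θ) (hθ1 : θ ≤ 1) : ScaleShiftRate 2 θ γ (roughFamily θ γ) := by
  intro k w _
  have h1 := abs_roughFamily_le_pow (γ := γ) hθ0 (k + 1) w
  have h2 := abs_roughFamily_le_pow (γ := γ) hθ0 k (Fin.tail w)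
  have hθk : θ ^ (k + 1) ≤ θ ^ k := pow_le_pow_of_le_one hθ0 hθ1 (Nat.le_succ k)
  calc |roughFamily θ γ (k + 1) w - roughFamily θ γ k (Fin.tail w)|
      ≤ |roughFamily θ γ (k + 1) w| + |roughFamily θ γ k (Fin.tail w)| := abs_sub _ _
    _ ≤ θ ^ (k + 1) + θ ^ k := add_le_add h1 h2
    _ ≤ 2 * θ ^ k := by linarith

/-- Amplitude × frequency is CONSTANT: `θ^k·ρ_k = π∕γ` (`θ > 0`). [folklore] -/
theorem pow_mul_roughFreq {θ γ : ℝ} (hθ0 : 0 < θ) (k : ℕ) : θ ^ k * roughFreq θ γ k = π / γ := by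
  unfold roughFreq
  field_simp

/-- The BOUNDED, OLDEST-ONLY moduli of the witness: `Λ♭ k i = (π∕γ)·[i = 0]` — one non-zero entry per row, the same at every scale. [folklore] -/
def roughModuli (γ : ℝ) : ℕ → ℕ → ℝ := fun _ i => if i = 0 then π / γ else 0

/-- **LIPSCHITZ MODULI, BOUNDED, NOT FADING**: `HistLipschitz (roughModuli γ) γ (roughFamily θ γ)` (`θ > 0`, `γ > 0`; `sin` is 1-Lipschitz and
`θ^k·ρ_k = π∕γ`). [folklore] -/
theorem histLipschitz_roughFamily {θ γ : ℝ} (hθ0 : 0 < θ) (hγ : 0 < γ) : HistLipschitz (roughModuli γ) γ (roughFamily θ γ) := by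
  intro k p q _ _
  have hsum : ∑ i : Fin (k + 1), roughModuli γ k i * |p i - q i| = π / γ * |p 0 - q 0| := by
    rw [Finset.sum_eq_single (0 : Fin (k + 1))]
    · simp [roughModuli]
    · intro j _ hj
      have : (j : ℕ) ≠ 0 := fun h => hj (Fin.ext h)
      simp [roughModuli, this]
    · simp
  rw [hsum]
  unfold roughFamily
  rw [← mul_sub, abs_mul, abs_of_nonneg (pow_nonneg hθ0.le k)]
  calc θ ^ k * |Real.sin (roughFreq θ γ k * p 0) - Real.sin (roughFreq θ γ k * q 0)|
      ≤ θ ^ k * |roughFreq θ γ k * p 0 - roughFreq θ γ k * q 0| :=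
        mul_le_mul_of_nonneg_left (Real.abs_sin_sub_sin_le _ _) (pow_nonneg hθ0.le k)
    _ = θ ^ k * roughFreq θ γ k * |p 0 - q 0| := by
        rw [← mul_sub, abs_mul, abs_of_nonneg (by unfold roughFreq; positivity), mul_assoc]
    _ = π / γ * |p 0 - q 0| := by rw [pow_mul_roughFreq hθ0]

/-- The rows of `roughModuli γ` sum to `π∕γ` ((E33)'s bounded-row-sum hypothesis holds). [folklore] -/
theorem sum_roughModuli (γ : ℝ) (k : ℕ) : ∑ i : Fin (k + 1), roughModuli γ k i = π / γ := by
  rw [Finset.sum_eq_single (0 : Fin (k + 1))]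
  · simp [roughModuli]
  · intro j _ hj
    have : (j : ℕ) ≠ 0 := fun h => hj (Fin.ext h)
    simp [roughModuli, this]
  · simp

/-! ## §2 Every admissible moduli family is `≥ 2∕γ` in the oldest coupling: no fading at any rate -/

/-- **NO ADMISSIBLE MODULUS DECAYS**: if `HistLipschitz Λ γ (roughFamily θ γ)` (`0 < θ ≤ 1`, `γ > 0`) then `2∕γ ≤ Λ k 0` at EVERY scale `k` —
histories `((γ∕2)θ^k, γ, …, γ)` and `(γθ^k, γ, …, γ)`, values `θ^k·sin(π∕2) = θ^k` and `θ^k·sin π = 0`. [folklore] -/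
theorem moduli_lower_roughFamily {θ γ : ℝ} (hθ0 : 0 < θ) (hθ1 : θ ≤ 1) (hγ : 0 < γ) {Λ : ℕ → ℕ → ℝ}
    (hL : HistLipschitz Λ γ (roughFamily θ γ)) (k : ℕ) : 2 / γ ≤ Λ k 0 := by
  set r : ℝ := θ ^ k with hr
  have hr0 : 0 < r := pow_pos hθ0 k
  have hr1 : r ≤ 1 := pow_le_one₀ hθ0.le hθ1
  set p : Fin (k + 1) → ℝ := Function.update (fun _ => γ) 0 (γ / 2 * r) with hp
  set q : Fin (k + 1) → ℝ := Function.update (fun _ => γ) 0 (γ * r) with hq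
  have hbox : ∀ x : ℝ, 0 < x → x ≤ γ → Function.update (fun _ : Fin (k + 1) => γ) 0 x ∈ Box γ k := fun x hx0 hxγ => by
    rw [mem_box]; intro j
    by_cases hj : j = 0
    · subst hj; simpa using ⟨hx0, hxγ⟩
    · rw [Function.update_of_ne hj]; exact ⟨hγ, le_rfl⟩
  have hpb : p ∈ Box γ k := hbox _ (by positivity) (by nlinarith)
  have hqb : q ∈ Box γ k := hbox _ (by positivity) (by nlinarith)
  have h := hL k p q hpb hqb
  have hρp : roughFreq θ γ k * p 0 = π / 2 := by
    simp only [hp, Function.update_self, roughFreq, hr]; field_simp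
  have hρq : roughFreq θ γ k * q 0 = π := by
    simp only [hq, Function.update_self, roughFreq, hr]; field_simp
  have hval : |roughFamily θ γ k p - roughFamily θ γ k q| = r := by
    simp only [roughFamily, hρp, hρq, Real.sin_pi_div_two, Real.sin_pi, mul_one, mul_zero, sub_zero]
    exact abs_of_nonneg hr0.le
  have hsum : ∑ i : Fin (k + 1), Λ k i * |p i - q i| = Λ k 0 * (γ / 2 * r) := by
    rw [Finset.sum_eq_single (0 : Fin (k + 1))]
    · simp only [hp, hq, Function.update_self, Fin.val_zero]
      rw [show γ / 2 * r - γ * r = -(γ / 2 * r) by ring, abs_neg, abs_of_pos (by positivity)]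
    · intro j _ hj
      simp [hp, hq, Function.update_of_ne hj]
    · simp
  rw [hval, hsum] at h
  -- `r ≤ Λ k 0 · (γ/2) · r` with `r > 0`
  have h' : r * (2 / γ) ≤ r * Λ k 0 := by
    calc r * (2 / γ) = (2 / γ) * r := mul_comm _ _
      _ ≤ (2 / γ) * (Λ k 0 * (γ / 2 * r)) := mul_le_mul_of_nonneg_left h (by positivity)
      _ = r * Λ k 0 := by field_simp
  exact le_of_mul_le_mul_left h' hr0

/-- **NO FADING AT ANY RATE `< 1`.**  For `0 < θ ≤ 1`, `γ > 0`, any `Λ` with `HistLipschitz Λ γ (roughFamily θ γ)`, any `C` and any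
`θ′ < 1`: `¬ FadingMemory C θ′ Λ` (else `2∕γ ≤ Cθ′^k`, and `θ′^k < (2∕γ)∕C` for some `k`). [folklore] -/
theorem not_fadingMemory_roughFamily {θ γ : ℝ} (hθ0 : 0 < θ) (hθ1 : θ ≤ 1) (hγ : 0 < γ) {Λ : ℕ → ℕ → ℝ}
    (hL : HistLipschitz Λ γ (roughFamily θ γ)) {C θ' : ℝ} (hθ'1 : θ' < 1) : ¬ FadingMemory C θ' Λ := by
  intro hF
  have hlow := moduli_lower_roughFamily hθ0 hθ1 hγ hL
  have hC : 2 / γ ≤ C := by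
    have h0 := (hF 0 0 le_rfl).2
    rw [Nat.sub_self, pow_zero, mul_one] at h0
    exact (hlow 0).trans h0
  have hC0 : 0 < C := lt_of_lt_of_le (by positivity) hC
  obtain ⟨n, hn⟩ := exists_pow_lt_of_lt_one (x := 2 / γ / C) (by positivity) hθ'1
  have h1 := hlow n
  have h2 := (hF n 0 (Nat.zero_le n)).2
  rw [Nat.sub_zero] at h2
  have h3 : C * θ' ^ n < 2 / γ := by
    have := mul_lt_mul_of_pos_left hn hC0
    rwa [mul_div_cancel₀ _ hC0.ne'] at this
  linarith

/-! ## §3 Packaging: at the Lipschitz level node U2's third hypothesis is independent of NE4 -/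

/-- **REGULARITY IS NECESSARY FOR DERIVING THE DECAY FROM NE4.**  For `0 < θ ≤ 1`, `γ > 0` the family `β := roughFamily θ γ` has NE4 at rate `θ`
(`ScaleShiftRate 2 θ γ β`), the uniform bound `|β| ≤ 1` on the boxes, and Lipschitz history moduli with bounded rows (`HistLipschitz (roughModuli γ) γ β`,
row sums `π∕γ`) — and NO `Λ` with `HistLipschitz Λ γ β` has `FadingMemory C θ′ Λ` for any `C` and any `θ′ < 1`.  Contrast
`histLipschitz_fadingMemory_of_smooth` (C^{1,1} ⇒ rate `√θ`) and `histLipschitz_fadingMemory_of_analytic` (analytic ⇒ rate `θ`). [folklore] -/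
theorem fading_needs_regularity {θ γ : ℝ} (hθ0 : 0 < θ) (hθ1 : θ ≤ 1) (hγ : 0 < γ) :
    ScaleShiftRate 2 θ γ (roughFamily θ γ) ∧ (∀ k (v : Fin (k + 1) → ℝ), v ∈ Box γ k → |roughFamily θ γ k v| ≤ 1) ∧
      HistLipschitz (roughModuli γ) γ (roughFamily θ γ) ∧ (∀ k, ∑ i : Fin (k + 1), roughModuli γ k i = π / γ) ∧
      ∀ (Λ : ℕ → ℕ → ℝ) (C θ' : ℝ), HistLipschitz Λ γ (roughFamily θ γ) → θ' < 1 → ¬ FadingMemory C θ' Λ :=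
  ⟨scaleShiftRate_roughFamily hθ0.le hθ1, fun k v _ => abs_roughFamily_le_one hθ0.le hθ1 k v, histLipschitz_roughFamily hθ0 hγ,
    sum_roughModuli γ, fun _ _ _ hL hθ'1 => not_fadingMemory_roughFamily hθ0 hθ1 hγ hL hθ'1⟩

end Summit.QuantumFields.BalabanUV.T4Continuum.Spine.NE4

end
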